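import Summits.NavierStokesRegularity.NavierStokesRegularity.Theses.RellichScar
import Summits.NavierStokesRegularity.NavierStokesRegularity.Theorems.SymmetricScarExists.Negative.SpiralWorld
import Summits.NavierStokesRegularity.NavierStokesRegularity.Theorems.SymmetricScarExists.Negative.RdssWall
import Summits.NavierStokesRegularity.NavierStokesRegularity.Theorems.RellichScarSymmetricScarExistsScaleWindowRigidity

/-!
# Window rigidity of the scar under rotations (crux `SymmetricScarExists`, line
# analytic-scar-window-rigidity, stub `stub_rotWindowRigidity`)

The SCAR of a field `u : ℝ → ℝ³ → ℝ³` is its trace at the final time `0` off the origin, compared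
through `SameScar u v` (the essential supremum of `‖u − v‖` over `(−δ, 0) × K` tends to `0` as
`δ ↓ 0`, for every compact `K ∌ 0`).  We prove the elementary group-theoretic upgrade used by the
line: if the rotation-conjugates `conjZ θ u` (`(t, x) ↦ R_θ u(t, R_{−θ} x)`) have the same scar as
`u` for all `θ` in a window `[a, b]` with `a < b`, then they do for ALL `θ` (`AxiScar u`).

* `SameScar` is an equivalence relation: the landed `sameScar_refl` (`Negative/SpiralWorld.lean`)
  and `sameScar_symm`, `sameScar_trans` (the scaling twin
  `RellichScarSymmetricScarExistsScaleWindowRigidity.lean`, imported);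
* `eLpNorm_conjZ_sub_conjZ` — change of variables: the scar functional of `conjZ θ f − conjZ θ g`
  on `(−δ,0) × K` equals that of `f − g` on `(−δ,0) × R_{−θ}K` (rotations preserve Lebesgue measure
  and norms); hence `sameScar_conjZ` — covariance of `SameScar` under `conjZ θ`;
* `sameScar_conjZ_add`, `sameScar_conjZ_neg`, `sameScar_conjZ_nsmul` — the stabiliser
  `{θ | SameScar (conjZ θ u) u}` is an additive subgroup of `ℝ`;
* `stub_rotWindowRigidity` — a subgroup of `ℝ` containing an interval of positive length is `ℝ`.
-/

noncomputable section

open MeasureTheory Set Function Filter Topology TopologicalSpace Metric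
open scoped NNReal ENNReal

namespace Summit.NavierStokesRegularity.NavierStokesRegularity.Theorems.SymmetricScarExists.ScarWindow

open Literature.Analysis.FluidPDE
open Summit.NavierStokesRegularity.NavierStokesRegularity.Theses.RellichScar
open Summit.NavierStokesRegularity.NavierStokesRegularity.Theorems.SymmetricScarExists.Negative

set_option linter.dupNamespace false

variable {u v : ℝ → EuclideanSpace ℝ (Fin 3) → EuclideanSpace ℝ (Fin 3)}

/-! ### Covariance of the scar functional under rotation-conjugation -/

/-- `R_θ` is additive: `R_θ a − R_θ b = R_θ (a − b)`. [folklore] -/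
theorem rotZ_sub (θ : ℝ) (a b : EuclideanSpace ℝ (Fin 3)) : rotZ θ a - rotZ θ b = rotZ θ (a - b) := by
  simpa using (map_sub (rotZIso θ) a b).symm

/-- Pointwise, `‖conjZ θ f (t, x) − conjZ θ g (t, x)‖ = ‖f(t, R_{−θ}x) − g(t, R_{−θ}x)‖`
(rotations are isometries). [folklore] -/
theorem norm_conjZ_sub_conjZ (θ : ℝ) (f g : ℝ → EuclideanSpace ℝ (Fin 3) → EuclideanSpace ℝ (Fin 3))
    (t : ℝ) (x : EuclideanSpace ℝ (Fin 3)) :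
    ‖conjZ θ f t x - conjZ θ g t x‖ = ‖f t (rotZ (-θ) x) - g t (rotZ (-θ) x)‖ := by
  simp only [conjZ]
  rw [rotZ_sub, norm_rotZ]

/-- The space-time map `(t, x) ↦ (t, R_θ x)` preserves Lebesgue measure on `ℝ × ℝ³`.
[folklore] -/
theorem measurePreserving_prodMap_rotZIso (θ : ℝ) :
    MeasurePreserving
      (Prod.map id (rotZIso θ) : ℝ × EuclideanSpace ℝ (Fin 3) → ℝ × EuclideanSpace ℝ (Fin 3))
      volume volume :=
  (MeasurePreserving.id volume).prod (rotZIso θ).measurePreserving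

/-- The space-time map `(t, x) ↦ (t, R_θ x)` is a measurable embedding. [folklore] -/
theorem measurableEmbedding_prodMap_rotZIso (θ : ℝ) :
    MeasurableEmbedding
      (Prod.map id (rotZIso θ) : ℝ × EuclideanSpace ℝ (Fin 3) → ℝ × EuclideanSpace ℝ (Fin 3)) :=
  MeasurableEmbedding.id.prodMap (rotZIso θ).toMeasurableEquiv.measurableEmbedding

/-- **Change of variables for the scar functional under rotation-conjugation**:
`‖conjZ θ f − conjZ θ g‖_{L^∞((−δ,0) × K)} = ‖f − g‖_{L^∞((−δ,0) × R_{−θ}K)}` (the rotation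
`(t, x) ↦ (t, R_{−θ}x)` preserves Lebesgue measure, and `R_θ` preserves norms). [folklore] -/
theorem eLpNorm_conjZ_sub_conjZ (θ : ℝ) (f g : ℝ → EuclideanSpace ℝ (Fin 3) → EuclideanSpace ℝ (Fin 3))
    (δ : ℝ) (K : Set (EuclideanSpace ℝ (Fin 3))) :
    eLpNorm (uncurry (conjZ θ f) - uncurry (conjZ θ g)) ⊤ (volume.restrict (Ioo (-δ) 0 ×ˢ K)) =
      eLpNorm (uncurry f - uncurry g) ⊤
        (volume.restrict (Ioo (-δ) 0 ×ˢ (rotZIso (-θ) '' K))) := by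
  have hΦ := measurePreserving_prodMap_rotZIso (-θ)
  have hΦe := measurableEmbedding_prodMap_rotZIso (-θ)
  -- the integrand is `R_θ ∘ ((f - g) ∘ Φ)`, of the same norm as `(f - g) ∘ Φ`
  have h1 : eLpNorm (uncurry (conjZ θ f) - uncurry (conjZ θ g)) ⊤
        (volume.restrict (Ioo (-δ) 0 ×ˢ K)) =
      eLpNorm ((uncurry f - uncurry g) ∘ Prod.map id (rotZIso (-θ))) ⊤
        (volume.restrict (Ioo (-δ) 0 ×ˢ K)) := by
    refine eLpNorm_congr_norm_ae (Eventually.of_forall fun z => ?_)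
    rcases z with ⟨t, x⟩
    show ‖conjZ θ f t x - conjZ θ g t x‖ = ‖f (id t) (rotZIso (-θ) x) - g (id t) (rotZIso (-θ) x)‖
    rw [norm_conjZ_sub_conjZ, id, rotZIso_apply]
  -- change of variables
  have hpre : Prod.map id (rotZIso (-θ)) ⁻¹' (Ioo (-δ) (0 : ℝ) ×ˢ (rotZIso (-θ) '' K)) =
      Ioo (-δ) 0 ×ˢ K := by
    rw [preimage_prod_map_prod, preimage_id, (rotZIso (-θ)).injective.preimage_image]
  have hres := hΦ.restrict_preimage_emb hΦe (Ioo (-δ) (0 : ℝ) ×ˢ (rotZIso (-θ) '' K))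
  rw [hpre] at hres
  rw [h1, ← hres.map_eq, hΦe.eLpNorm_map_measure]

/-- A rotation maps a compact set missing the origin to a compact set missing the origin.
[folklore] -/
theorem isCompact_image_rotZIso (θ : ℝ) {K : Set (EuclideanSpace ℝ (Fin 3))} (hK : IsCompact K)
    (h0 : (0 : EuclideanSpace ℝ (Fin 3)) ∉ K) :
    IsCompact (rotZIso θ '' K) ∧ (0 : EuclideanSpace ℝ (Fin 3)) ∉ rotZIso θ '' K := by
  refine ⟨hK.image (rotZIso θ).continuous, ?_⟩
  rintro ⟨x, hx, hx0⟩
  have hx' : x = 0 := (rotZIso θ).injective (hx0.trans (map_zero (rotZIso θ)).symm)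
  exact h0 (hx' ▸ hx)

/-- **`SameScar` is covariant under rotation-conjugation.** [folklore] -/
theorem sameScar_conjZ (θ : ℝ) (h : SameScar u v) : SameScar (conjZ θ u) (conjZ θ v) := by
  intro K hK h0
  obtain ⟨hK', h0'⟩ := isCompact_image_rotZIso (-θ) hK h0
  exact (h _ hK' h0').congr fun δ => (eLpNorm_conjZ_sub_conjZ θ u v δ K).symm

/-! ### The stabiliser `{θ | SameScar (conjZ θ u) u}` is a subgroup of `ℝ` -/

/-- `0` is in the stabiliser. [folklore] -/
theorem sameScar_conjZ_zero (u : ℝ → EuclideanSpace ℝ (Fin 3) → EuclideanSpace ℝ (Fin 3)) :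
    SameScar (conjZ 0 u) u := by
  rw [conjZ_zero]
  exact sameScar_refl u

/-- The stabiliser is closed under addition (`conjZ (θ + φ) = conjZ θ ∘ conjZ φ`, covariance,
transitivity). [folklore] -/
theorem sameScar_conjZ_add {θ φ : ℝ} (hθ : SameScar (conjZ θ u) u) (hφ : SameScar (conjZ φ u) u) :
    SameScar (conjZ (θ + φ) u) u := by
  rw [← conjZ_conjZ]
  exact sameScar_trans (sameScar_conjZ θ hφ) hθ

/-- The stabiliser is closed under negation (conjugate by `−θ` and use symmetry). [folklore] -/
theorem sameScar_conjZ_neg {θ : ℝ} (hθ : SameScar (conjZ θ u) u) : SameScar (conjZ (-θ) u) u := by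
  have h := sameScar_conjZ (-θ) hθ
  rw [conjZ_conjZ, neg_add_cancel, conjZ_zero] at h
  exact sameScar_symm h

/-- The stabiliser is closed under natural multiples. [folklore] -/
theorem sameScar_conjZ_nsmul {θ : ℝ} (hθ : SameScar (conjZ θ u) u) (n : ℕ) :
    SameScar (conjZ (n * θ) u) u := by
  induction n with
  | zero => simpa using sameScar_conjZ_zero u
  | succ n ih =>
    rw [Nat.cast_succ, add_mul, one_mul]
    exact sameScar_conjZ_add ih hθ

/-! ### Window rigidity -/

/-- **Window rigidity of the scar under rotations.**  If every rotation-conjugate `conjZ θ u` with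
`θ` in a window `[a, b]`, `a < b`, has the same scar as `u`, then so does every rotation-conjugate
(`AxiScar u`): the stabiliser `{θ | SameScar (conjZ θ u) u}` is an additive subgroup of `ℝ`
containing `[a, b]`, hence the differences `[−(b − a), b − a]`, hence (every real being a natural
multiple of a small one) all of `ℝ`. [folklore] -/
theorem stub_rotWindowRigidity :
    ∀ (u : ℝ → EuclideanSpace ℝ (Fin 3) → EuclideanSpace ℝ (Fin 3)) (a b : ℝ), a < b →
      (∀ θ ∈ Icc a b, SameScar (conjZ θ u) u) → AxiScar u := by
  intro u a b hab hwin θ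
  have hba : 0 < b - a := sub_pos.mpr hab
  -- small angles are differences of two window angles
  have hsmall : ∀ ψ : ℝ, |ψ| ≤ b - a → SameScar (conjZ ψ u) u := by
    intro ψ hψ
    obtain ⟨h1, h2⟩ := abs_le.mp hψ
    have hx : (a + b) / 2 + ψ / 2 ∈ Icc a b := ⟨by linarith, by linarith⟩
    have hy : (a + b) / 2 - ψ / 2 ∈ Icc a b := ⟨by linarith, by linarith⟩
    have h := sameScar_conjZ_add (hwin _ hx) (sameScar_conjZ_neg (hwin _ hy))
    have e : (a + b) / 2 + ψ / 2 + -((a + b) / 2 - ψ / 2) = ψ := by ring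
    rwa [e] at h
  -- every angle is a natural multiple of a small one
  obtain ⟨n, hn⟩ := exists_nat_gt (|θ| / (b - a))
  have hnpos : (0 : ℝ) < n := lt_of_le_of_lt (div_nonneg (abs_nonneg θ) hba.le) hn
  have hψ : |θ / n| ≤ b - a := by
    rw [abs_div, abs_of_pos hnpos, div_le_iff₀ hnpos]
    rw [div_lt_iff₀ hba] at hn
    nlinarith
  have h := sameScar_conjZ_nsmul (hsmall _ hψ) n
  rwa [mul_div_cancel₀ _ hnpos.ne'] at h

end Summit.NavierStokesRegularity.NavierStokesRegularity.Theorems.SymmetricScarExists.ScarWindow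

end
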